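import Mathlib

/-!
# Route «KPlusLogSqLaw», crux `WeakLifting` (stmt-ValiantsHypothesis-19561) — α row, RESOLVED limit:
# the slope budget of a swap chain and the two PURE cases of conjecture `D^comb` (g17)

HONEST FRAMING.  Helper lemmas (`--supports stmt-ValiantsHypothesis-19561 --as helper`), seat pub-symmetroid-conjb-2 (g17), cell `pub-symmetroid`,
2026-08-28.  Elementary; def-free; resolved (tropical) limit only; nothing here is a root count and nothing bears on `WeakLifting` / `TropicalB` in
their windows, on Conjecture B (`KPlusLogSqLaw`), on `MatrixDescartes` or on VP ≠ VNP.

CONTENT (paper: HOME/pub-symmetroid-conjb-2/g17/theory/THEORY-NOTE-g17.md §4.8(f3)).  Along the upper envelope of the α-row tropical problem the optimal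
matching runs through a chain `M 0, M 1, …, M n` of edge sets `⊆ range N` whose slopes `Σ_{e ∈ M k} λ_e` strictly increase (integer edge word `λ`).
Conjecture `D^comb` (THEORY-NOTE-g17 §4.8(e); exact for all two-speed words with `N ≤ 6`) bounds the number of parity-changing steps of such a chain by
`N` when `λ_e ∈ {±1, ±2}` and no block is swapped twice.  This file proves the SLOPE-BUDGET half, which needs neither matchings nor blocks:
* `slope_budget` — if every step gains at least `d`, then `d · n ≤ Σ_{e<N} |λ_e|` (telescoping + sign split of the two end slopes).
* `chain_len_le_of_slow` — ALL-SLOW words (`λ_e = ±1`): `n ≤ N` (budget `Σ|λ| = N`, gains `≥ 1`).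
* `chain_len_le_of_fast` — ALL-FAST words (`λ_e = ±2`): `n ≤ N` (all slopes even, so gains `≥ 2`; budget `2N`).
So `D^comb` — indeed the bound `n ≤ N` on ALL steps — holds for pure words; the conjecture is about MIXED words (where the budget can reach `2N`
while gain-1 steps exist), cf. the META NO-GO word `(−2,2,1,−1,1)` of THEORY-NOTE-g17 §4.8(b).  [this seat; elementary]
-/

-- `Summit.ValiantsHypothesis.ValiantsHypothesis.…` repeats a component by the D-0017 layout (single-conjunct summit); the name is mandated.
set_option linter.dupNamespace false

namespace Summit.ValiantsHypothesis.ValiantsHypothesis.Theorems.KPlusLogSqLaw.ResolvedChainBudget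

open Finset

/-- Sign split of one integer: `max x 0 - min x 0 = |x|`. -/
theorem max_sub_min_eq_abs (x : ℤ) : max x 0 - min x 0 = |x| := by
  rcases le_total 0 x with h | h
  · rw [max_eq_left h, min_eq_right h, abs_of_nonneg h, sub_zero]
  · rw [max_eq_right h, min_eq_left h, abs_of_nonpos h, zero_sub]

/-- The slope of an edge set inside `range N` lies between `Σ min(λ_e,0)` and `Σ max(λ_e,0)`. -/
theorem slope_le_sum_max (N : ℕ) (lam : ℕ → ℤ) (μ : Finset ℕ) (hμ : μ ⊆ range N) :
    ∑ e ∈ μ, lam e ≤ ∑ e ∈ range N, max (lam e) 0 := by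
  calc ∑ e ∈ μ, lam e ≤ ∑ e ∈ μ, max (lam e) 0 := sum_le_sum fun e _ => le_max_left _ _
    _ ≤ ∑ e ∈ range N, max (lam e) 0 :=
        sum_le_sum_of_subset_of_nonneg hμ fun e _ _ => le_max_right _ _

/-- Lower half of the sign split: `Σ_{e<N} min(λ_e,0) ≤` the slope of any edge set inside `range N`. -/
theorem sum_min_le_slope (N : ℕ) (lam : ℕ → ℤ) (μ : Finset ℕ) (hμ : μ ⊆ range N) :
    ∑ e ∈ range N, min (lam e) 0 ≤ ∑ e ∈ μ, lam e := by
  have hsplit := sum_sdiff hμ (f := fun e => min (lam e) 0)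
  have hneg : ∑ e ∈ range N \ μ, min (lam e) 0 ≤ 0 := sum_nonpos fun e _ => min_le_right _ _
  have hle : ∑ e ∈ μ, min (lam e) 0 ≤ ∑ e ∈ μ, lam e := sum_le_sum fun e _ => min_le_left _ _
  linarith

/-- THE SLOPE BUDGET.  Edge sets `M 0, …, M n ⊆ range N`; if each step `M k → M (k+1)` (`k < n`) raises the slope `Σ_{e ∈ M k} λ_e` by at least `d`,
then `d · n ≤ Σ_{e < N} |λ_e|`. -/
theorem slope_budget (N n : ℕ) (lam : ℕ → ℤ) (M : ℕ → Finset ℕ) (d : ℤ)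
    (hM : ∀ k, k ≤ n → M k ⊆ range N)
    (hd : ∀ k, k < n → d ≤ (∑ e ∈ M (k + 1), lam e) - ∑ e ∈ M k, lam e) :
    d * n ≤ ∑ e ∈ range N, |lam e| := by
  set s : ℕ → ℤ := fun k => ∑ e ∈ M k, lam e with hs
  have htel : ∑ k ∈ range n, (s (k + 1) - s k) = s n - s 0 := sum_range_sub s n
  have hsteps : d * n ≤ ∑ k ∈ range n, (s (k + 1) - s k) := by
    have : ∑ k ∈ range n, d ≤ ∑ k ∈ range n, (s (k + 1) - s k) :=
      sum_le_sum fun k hk => hd k (mem_range.mp hk)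
    simpa [sum_const, card_range, mul_comm] using this
  have htop : s n ≤ ∑ e ∈ range N, max (lam e) 0 := slope_le_sum_max N lam (M n) (hM n le_rfl)
  have hbot : ∑ e ∈ range N, min (lam e) 0 ≤ s 0 := sum_min_le_slope N lam (M 0) (hM 0 (Nat.zero_le n))
  have habs : ∑ e ∈ range N, |lam e| = (∑ e ∈ range N, max (lam e) 0) - ∑ e ∈ range N, min (lam e) 0 := by
    rw [← sum_sub_distrib]; exact sum_congr rfl fun e _ => (max_sub_min_eq_abs (lam e)).symm
  rw [habs]; linarith

/-- ALL-SLOW WORDS.  If `λ_e ∈ {1, −1}` for `e < N` and the slopes of `M 0, …, M n ⊆ range N` strictly increase, then `n ≤ N`: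
the whole chain — not only its parity-changing steps — has at most `N` steps (pure case of conjecture `D^comb`). -/
theorem chain_len_le_of_slow (N n : ℕ) (lam : ℕ → ℤ) (M : ℕ → Finset ℕ)
    (hlam : ∀ e, e < N → lam e = 1 ∨ lam e = -1)
    (hM : ∀ k, k ≤ n → M k ⊆ range N)
    (hmono : ∀ k, k < n → (∑ e ∈ M k, lam e) < ∑ e ∈ M (k + 1), lam e) :
    n ≤ N := by
  have hb := slope_budget N n lam M 1 hM (fun k hk => by have := hmono k hk; linarith)
  have habs : ∑ e ∈ range N, |lam e| = N := by
    have : ∀ e ∈ range N, |lam e| = 1 := fun e he => by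
      rcases hlam e (mem_range.mp he) with h | h <;> simp [h]
    rw [sum_congr rfl this]; simp
  rw [habs] at hb
  exact_mod_cast (by linarith : (n : ℤ) ≤ N)

/-- ALL-FAST WORDS.  If `λ_e ∈ {2, −2}` for `e < N` and the slopes of `M 0, …, M n ⊆ range N` strictly increase, then `n ≤ N`
(every slope is even, so every gain is at least `2`, against a budget of `2N`). -/
theorem chain_len_le_of_fast (N n : ℕ) (lam : ℕ → ℤ) (M : ℕ → Finset ℕ)
    (hlam : ∀ e, e < N → lam e = 2 ∨ lam e = -2)
    (hM : ∀ k, k ≤ n → M k ⊆ range N)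
    (hmono : ∀ k, k < n → (∑ e ∈ M k, lam e) < ∑ e ∈ M (k + 1), lam e) :
    n ≤ N := by
  have heven : ∀ k, k ≤ n → (2 : ℤ) ∣ ∑ e ∈ M k, lam e := fun k hk =>
    dvd_sum fun e he => by
      rcases hlam e (mem_range.mp (hM k hk he)) with h | h <;> simp [h]
  have hb := slope_budget N n lam M 2 hM (fun k hk => by
    have h1 := hmono k hk
    obtain ⟨x, hx⟩ := heven k hk.le
    obtain ⟨y, hy⟩ := heven (k + 1) hk
    rw [hx, hy] at h1 ⊢; linarith [(by linarith : x < y), (Int.add_one_le_iff.mpr (by linarith : x < y))])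
  have habs : ∑ e ∈ range N, |lam e| = 2 * N := by
    have : ∀ e ∈ range N, |lam e| = 2 := fun e he => by
      rcases hlam e (mem_range.mp he) with h | h <;> simp [h]
    rw [sum_congr rfl this]; simp [mul_comm]
  rw [habs] at hb
  exact_mod_cast (by linarith : (n : ℤ) ≤ N)

end Summit.ValiantsHypothesis.ValiantsHypothesis.Theorems.KPlusLogSqLaw.ResolvedChainBudget
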